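import Summits.BirchSwinnertonDyer.BirchSwinnertonDyer.Theorems.ThetaPartnerAtTwoSignedTransportAtTwoStubSel2Tb
import Summits.BirchSwinnertonDyer.BirchSwinnertonDyer.Theorems.ThetaPartnerAtTwoSignedTransportAtTwoResidualTransport
import Summits.BirchSwinnertonDyer.BirchSwinnertonDyer.Theorems.ThetaPartnerAtTwoSignedTransportAtTwoResidualTransportPoints
import Summits.BirchSwinnertonDyer.BirchSwinnertonDyer.Theorems.ThetaPartnerAtTwoSignedTransportAtTwoEquivariantSignedLocalPoints
import Literature.NumberTheory.EllipticCurves.GreenbergVatsal2000.GreenbergSelmerGroups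
import HarnessLib

/-!
# The residual signed Selmer conditions of `W` and `A` CORRESPOND under `ẽ_*` (Kim 2009 Prop. 2.12 READ AT `2`) — for the crux
# `SignedTransportAtTwo` (stmt-BirchSwinnertonDyer-20333, route `ThetaPartnerAtTwo`, line `bridge` v17; input (L4) of the
# remaining stub `stub_lam2d`) (lead prover bsd-wall-tp2-p1 g5; `--supports stmt-BirchSwinnertonDyer-20333`; route-independent,
# closes nothing)

HONEST FRAMING. THEOREMS ONLY (no definition); nothing about any characteristic ideal is asserted; BSD is not proved by any of
this. No import of any route file.

WHAT. `H = Gal(ℚ̄/ℚ_∞)`, `M_E = E[2^∞][2]`, `ẽ : M_W ≃ M_A` `Γ_ℚ`-equivariant, `ẽ_* = pushH1`. The three transportable conditions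
on a class `c ∈ H¹(H, M_E)` of the residual devissage (unramified outside `S₀ ∪ {2}`; trivial at the archimedean places after every
conjugation; signed Kummer condition at `2` with respect to `⨆ₙ E⁺(ℚ_{n,2})` after every conjugation) cut out `R♯(E)`.
With the local transport now available in BOTH directions (`exists_equivariant_hom_of_algebra` is symmetric in `(W, A)`):
* `signedKummer_transport` — the signed Kummer condition at `2` passes from `W` to `A` along ANY equivariant `ẽ`, for any
  pair of globally minimal curves good supersingular at `2` with `a₂ = 0` (v16's `sel2T_of_Ta`, freed of the habitat
  decorations);
* **`pushH1_mem_residualSharp_iff`** — `c ∈ R♯(W) ↔ ẽ_* c ∈ R♯(A)`; with `ẽ_*` bijective (p537955) this is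
  `R♯(W) ≅ R♯(A)`, the mod-`2` comparison entering Kim's `λ`-formula (Cor. 2.13) at `p = 2`.

References: [BDKim2009] Prop. 2.9–2.12, Cor. 2.13 (p. 186); [GreenbergVatsal2000] §2 pp. 17–28; [Kobayashi2003] §8.4.
-/

set_option autoImplicit false
-- D-0017: single-problem summit, so `Summit.BirchSwinnertonDyer.BirchSwinnertonDyer.…` repeats a namespace BY DESIGN.
set_option linter.dupNamespace false

noncomputable section

open scoped Classical AddSubgroup

open WeierstrassCurve NumberField IsDedekindDomain Literature.NumberTheory.EllipticCurves
  Literature.NumberTheory.EllipticCurves.Rank1Residual Literature.NumberTheory.EllipticCurves.Kobayashi2003 ZpExtension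
  Literature.NumberTheory.EllipticCurves.GreenbergVatsal2000 Literature.NumberTheory.GaloisRepresentations Field

namespace Summit.BirchSwinnertonDyer.BirchSwinnertonDyer.Theorems.SignedTransportAtTwo

universe u

variable (W A : WeierstrassCurve ℚ) [W.IsElliptic] [W.IsGloballyMinimal] [A.IsElliptic] [A.IsGloballyMinimal]

/-- **Transport of the signed Kummer condition at `2`** along an equivariant `ẽ : W[2^∞][2] ≃ A[2^∞][2]`, for ANY pair of globally
minimal curves good supersingular at `2` with `a₂ = 0` (v16's `sel2T_of_Ta` ∘ `sel2Ta_of_Tb`, with `stub_sel2Tb` replaced by the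
landed symmetric `exists_equivariant_hom_of_algebra`): a residual class whose Kummer image satisfies Kobayashi's `+`-condition
at `2` over `ℚ_∞` for `W` (after conjugation by `σ`) has `ẽ_*`-image satisfying it for `A`.
[cite: BDKim2009, Prop. 2.11–2.12 (p. 186)] [cite: Kobayashi2003, §8.4] -/
theorem signedKummer_transport (hssW : GoodSS W 2) (ha2W : W.frobeniusTrace 2 = 0) (hssA : GoodSS A 2)
    (ha2A : A.frobeniusTrace 2 = 0) (κ : ZpExtension ℚ 2)
    (e' : ↥((↥(W.geomPrimaryTorsion 2))[(2 : ℤ)]) ≃+ ↥((↥(A.geomPrimaryTorsion 2))[(2 : ℤ)]))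
    (he' : ∀ (σ : Field.absoluteGaloisGroup ℚ) (x : ↥((↥(W.geomPrimaryTorsion 2))[(2 : ℤ)])), e' (σ • x) = σ • e' x)
    (c : subgroupH1 κ.kerSubgroup ↥((↥(W.geomPrimaryTorsion 2))[(2 : ℤ)]))
    {v : HeightOneSpectrum (𝓞 ℚ)} (hv : ((2 : ℕ) : 𝓞 ℚ) ∈ v.asIdeal) (σ : Field.absoluteGaloisGroup ℚ)
    (hc : W.conjH1 2 κ.kerSubgroup σ
        (pushH1 κ.kerSubgroup ((↥(W.geomPrimaryTorsion 2))[(2 : ℤ)]).subtype (subtype_torsionBy_smul W 2) c) ∈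
      localKummerOverOfEmb W 2 κ.kerSubgroup (closureEmb (K := ℚ) (v.adicCompletion ℚ))
        (⨆ n : ℕ, signedLocalPoints κ (v.adicCompletion ℚ) W 1 n)) :
    A.conjH1 2 κ.kerSubgroup σ
        (pushH1 κ.kerSubgroup ((↥(A.geomPrimaryTorsion 2))[(2 : ℤ)]).subtype (subtype_torsionBy_smul A 2)
          (pushH1 κ.kerSubgroup e'.toAddMonoidHom he' c)) ∈
      localKummerOverOfEmb A 2 κ.kerSubgroup (closureEmb (K := ℚ) (v.adicCompletion ℚ))
        (⨆ n : ℕ, signedLocalPoints κ (v.adicCompletion ℚ) A 1 n) := by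
  -- the local transport at `v`, in the currency of local points
  obtain ⟨e⟩ := nonempty_algEquiv_padic_adicCompletion (p := 2) (v := v) (by exact_mod_cast hv)
  letI : Algebra ℚ_[2] (v.adicCompletion ℚ) := (e : ℚ_[2] →ₐ[ℚ] v.adicCompletion ℚ).toRingHom.toAlgebra
  haveI : IsScalarTower ℚ ℚ_[2] (v.adicCompletion ℚ) :=
    IsScalarTower.of_algebraMap_eq fun r ↦ ((e : ℚ_[2] →ₐ[ℚ] v.adicCompletion ℚ).commutes r).symm
  haveI : Algebra.IsAlgebraic ℚ_[2] (v.adicCompletion ℚ) := ⟨fun x ↦ by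
    have hx : x = algebraMap ℚ_[2] (v.adicCompletion ℚ) (e.symm x) := (e.apply_symm_apply x).symm
    rw [hx]
    exact isAlgebraic_algebraMap _⟩
  obtain ⟨Ψ, hΨ, hΨe⟩ := exists_equivariant_hom_of_algebra W A (v.adicCompletion ℚ) hssW ha2W hssA ha2A e' he'
  have hΨplus : ∀ n : ℕ, (signedLocalPoints κ (v.adicCompletion ℚ) W 1 n).map Ψ ≤ signedLocalPoints κ (v.adicCompletion ℚ) A 1 n :=
    fun n ↦ map_signedLocalPointsOfEmb_le κ (closureEmb (K := ℚ) (v.adicCompletion ℚ)) W A Ψ hΨ 1 n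
  -- move the conjugation inside both Kummer maps
  have h1 : A.conjH1 2 κ.kerSubgroup σ
      (pushH1 κ.kerSubgroup ((↥(A.geomPrimaryTorsion 2))[(2 : ℤ)]).subtype (subtype_torsionBy_smul A 2)
        (pushH1 κ.kerSubgroup e'.toAddMonoidHom he' c)) =
      pushH1 κ.kerSubgroup ((↥(A.geomPrimaryTorsion 2))[(2 : ℤ)]).subtype (subtype_torsionBy_smul A 2)
        (Literature.NumberTheory.EllipticCurves.conjH1 κ.kerSubgroup _ σ (pushH1 κ.kerSubgroup e'.toAddMonoidHom he' c)) :=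
    (pushH1_conjH1 κ.kerSubgroup ((↥(A.geomPrimaryTorsion 2))[(2 : ℤ)]).subtype (subtype_torsionBy_smul A 2) σ _).symm
  have h2 : Literature.NumberTheory.EllipticCurves.conjH1 κ.kerSubgroup _ σ (pushH1 κ.kerSubgroup e'.toAddMonoidHom he' c) =
      pushH1 κ.kerSubgroup e'.toAddMonoidHom he'
        (Literature.NumberTheory.EllipticCurves.conjH1 κ.kerSubgroup _ σ c) :=
    (pushH1_conjH1 κ.kerSubgroup e'.toAddMonoidHom he' σ c).symm
  rw [h1, h2]
  have hcW' := hc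
  have h3 : W.conjH1 2 κ.kerSubgroup σ
      (pushH1 κ.kerSubgroup ((↥(W.geomPrimaryTorsion 2))[(2 : ℤ)]).subtype (subtype_torsionBy_smul W 2) c) =
      pushH1 κ.kerSubgroup ((↥(W.geomPrimaryTorsion 2))[(2 : ℤ)]).subtype (subtype_torsionBy_smul W 2)
        (Literature.NumberTheory.EllipticCurves.conjH1 κ.kerSubgroup _ σ c) :=
    (pushH1_conjH1 κ.kerSubgroup ((↥(W.geomPrimaryTorsion 2))[(2 : ℤ)]).subtype (subtype_torsionBy_smul W 2) σ c).symm
  rw [h3] at hcW'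
  refine pushH1_mem_localKummerOverOfEmb_of_transport W A 2 κ.kerSubgroup (closureEmb (K := ℚ) (v.adicCompletion ℚ))
    e' he' Ψ hΨ _ _ ?_ hΨe _ hcW'
  rw [AddSubgroup.map_iSup]
  exact iSup_mono fun n ↦ hΨplus n

omit [W.IsElliptic] [W.IsGloballyMinimal] [A.IsElliptic] [A.IsGloballyMinimal] in
/-- `ẽ⁻¹_* (ẽ_* c) = c` on `H¹(H, ·)` (functoriality, p537955's `resH1Hom_symm_comp_resH1Hom`). [folklore] -/
theorem pushH1_symm_pushH1 (H : Subgroup (Field.absoluteGaloisGroup ℚ))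
    (e' : ↥((↥(W.geomPrimaryTorsion 2))[(2 : ℤ)]) ≃+ ↥((↥(A.geomPrimaryTorsion 2))[(2 : ℤ)]))
    (he' : ∀ (σ : Field.absoluteGaloisGroup ℚ) (x : ↥((↥(W.geomPrimaryTorsion 2))[(2 : ℤ)])), e' (σ • x) = σ • e' x)
    (c : subgroupH1 H ↥((↥(W.geomPrimaryTorsion 2))[(2 : ℤ)])) :
    pushH1 H e'.symm.toAddMonoidHom (addEquiv_symm_smul e' he') (pushH1 H e'.toAddMonoidHom he' c) = c :=
  DFunLike.congr_fun (resH1Hom_symm_comp_resH1Hom (G := ↥H) e' fun g x ↦ he' g x) c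

/-- **Kim 2009 Prop. 2.12 READ AT `2` (residual form): the three transportable conditions CORRESPOND under `ẽ_*`.** For `W, A`
globally minimal, good supersingular at `2` with `a₂ = 0`, `κ` a `ℤ₂`-extension, `S₀` a set of places and an equivariant
`ẽ : W[2^∞][2] ≃ A[2^∞][2]`: a class `c ∈ H¹(H, W[2^∞][2])` is unramified outside `S₀ ∪ {2}`, residually trivial at the
archimedean places and satisfies the signed Kummer condition at `2` (each after every conjugation) IF AND ONLY IF `ẽ_* c` does so
for `A`. With `ẽ_*` bijective (p537955) this is the isomorphism `R♯(W) ≅ R♯(A)` of the residual signed Selmer groups, the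
mod-`2` input of the `λ`-formula (Cor. 2.13). [cite: BDKim2009, Prop. 2.12 and Cor. 2.13 (p. 186)] [cite: GreenbergVatsal2000, §2 p. 28] -/
theorem mem_residualSharp_iff_pushH1 (hssW : GoodSS W 2) (ha2W : W.frobeniusTrace 2 = 0) (hssA : GoodSS A 2)
    (ha2A : A.frobeniusTrace 2 = 0) (κ : ZpExtension ℚ 2) (S₀ : Set (HeightOneSpectrum (𝓞 ℚ)))
    (e' : ↥((↥(W.geomPrimaryTorsion 2))[(2 : ℤ)]) ≃+ ↥((↥(A.geomPrimaryTorsion 2))[(2 : ℤ)]))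
    (he' : ∀ (σ : Field.absoluteGaloisGroup ℚ) (x : ↥((↥(W.geomPrimaryTorsion 2))[(2 : ℤ)])), e' (σ • x) = σ • e' x)
    (c : subgroupH1 κ.kerSubgroup ↥((↥(W.geomPrimaryTorsion 2))[(2 : ℤ)])) :
    (c ∈ unramifiedOutside κ.kerSubgroup ↥((↥(W.geomPrimaryTorsion 2))[(2 : ℤ)]) 2 S₀ ∧
      (∀ (w : InfinitePlace ℚ) (σ : Field.absoluteGaloisGroup ℚ),
        Literature.NumberTheory.EllipticCurves.conjH1 κ.kerSubgroup ↥((↥(W.geomPrimaryTorsion 2))[(2 : ℤ)]) σ c ∈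
          GreenbergSelmer.infKer κ.kerSubgroup ↥((↥(W.geomPrimaryTorsion 2))[(2 : ℤ)]) w) ∧
      (∀ (v : HeightOneSpectrum (𝓞 ℚ)), ((2 : ℕ) : 𝓞 ℚ) ∈ v.asIdeal → ∀ σ : Field.absoluteGaloisGroup ℚ,
        W.conjH1 2 κ.kerSubgroup σ
            (pushH1 κ.kerSubgroup ((↥(W.geomPrimaryTorsion 2))[(2 : ℤ)]).subtype (subtype_torsionBy_smul W 2) c) ∈
          localKummerOverOfEmb W 2 κ.kerSubgroup (closureEmb (K := ℚ) (v.adicCompletion ℚ))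
            (⨆ n : ℕ, signedLocalPoints κ (v.adicCompletion ℚ) W 1 n))) ↔
    (pushH1 κ.kerSubgroup e'.toAddMonoidHom he' c ∈
        unramifiedOutside κ.kerSubgroup ↥((↥(A.geomPrimaryTorsion 2))[(2 : ℤ)]) 2 S₀ ∧
      (∀ (w : InfinitePlace ℚ) (σ : Field.absoluteGaloisGroup ℚ),
        Literature.NumberTheory.EllipticCurves.conjH1 κ.kerSubgroup ↥((↥(A.geomPrimaryTorsion 2))[(2 : ℤ)]) σ
            (pushH1 κ.kerSubgroup e'.toAddMonoidHom he' c) ∈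
          GreenbergSelmer.infKer κ.kerSubgroup ↥((↥(A.geomPrimaryTorsion 2))[(2 : ℤ)]) w) ∧
      (∀ (v : HeightOneSpectrum (𝓞 ℚ)), ((2 : ℕ) : 𝓞 ℚ) ∈ v.asIdeal → ∀ σ : Field.absoluteGaloisGroup ℚ,
        A.conjH1 2 κ.kerSubgroup σ
            (pushH1 κ.kerSubgroup ((↥(A.geomPrimaryTorsion 2))[(2 : ℤ)]).subtype (subtype_torsionBy_smul A 2)
              (pushH1 κ.kerSubgroup e'.toAddMonoidHom he' c)) ∈
          localKummerOverOfEmb A 2 κ.kerSubgroup (closureEmb (K := ℚ) (v.adicCompletion ℚ))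
            (⨆ n : ℕ, signedLocalPoints κ (v.adicCompletion ℚ) A 1 n))) := by
  -- one direction for an arbitrary pair, then apply it to `(A, W, ẽ⁻¹)`
  have key : ∀ (W A : WeierstrassCurve ℚ) [W.IsElliptic] [W.IsGloballyMinimal] [A.IsElliptic] [A.IsGloballyMinimal],
      GoodSS W 2 → W.frobeniusTrace 2 = 0 → GoodSS A 2 → A.frobeniusTrace 2 = 0 →
      ∀ (e' : ↥((↥(W.geomPrimaryTorsion 2))[(2 : ℤ)]) ≃+ ↥((↥(A.geomPrimaryTorsion 2))[(2 : ℤ)]))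
        (he' : ∀ (σ : Field.absoluteGaloisGroup ℚ) (x : ↥((↥(W.geomPrimaryTorsion 2))[(2 : ℤ)])), e' (σ • x) = σ • e' x)
        (c : subgroupH1 κ.kerSubgroup ↥((↥(W.geomPrimaryTorsion 2))[(2 : ℤ)])),
      (c ∈ unramifiedOutside κ.kerSubgroup ↥((↥(W.geomPrimaryTorsion 2))[(2 : ℤ)]) 2 S₀ ∧
        (∀ (w : InfinitePlace ℚ) (σ : Field.absoluteGaloisGroup ℚ),
          Literature.NumberTheory.EllipticCurves.conjH1 κ.kerSubgroup ↥((↥(W.geomPrimaryTorsion 2))[(2 : ℤ)]) σ c ∈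
            GreenbergSelmer.infKer κ.kerSubgroup ↥((↥(W.geomPrimaryTorsion 2))[(2 : ℤ)]) w) ∧
        (∀ (v : HeightOneSpectrum (𝓞 ℚ)), ((2 : ℕ) : 𝓞 ℚ) ∈ v.asIdeal → ∀ σ : Field.absoluteGaloisGroup ℚ,
          W.conjH1 2 κ.kerSubgroup σ
              (pushH1 κ.kerSubgroup ((↥(W.geomPrimaryTorsion 2))[(2 : ℤ)]).subtype (subtype_torsionBy_smul W 2) c) ∈
            localKummerOverOfEmb W 2 κ.kerSubgroup (closureEmb (K := ℚ) (v.adicCompletion ℚ))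
              (⨆ n : ℕ, signedLocalPoints κ (v.adicCompletion ℚ) W 1 n))) →
      (pushH1 κ.kerSubgroup e'.toAddMonoidHom he' c ∈
          unramifiedOutside κ.kerSubgroup ↥((↥(A.geomPrimaryTorsion 2))[(2 : ℤ)]) 2 S₀ ∧
        (∀ (w : InfinitePlace ℚ) (σ : Field.absoluteGaloisGroup ℚ),
          Literature.NumberTheory.EllipticCurves.conjH1 κ.kerSubgroup ↥((↥(A.geomPrimaryTorsion 2))[(2 : ℤ)]) σ
              (pushH1 κ.kerSubgroup e'.toAddMonoidHom he' c) ∈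
            GreenbergSelmer.infKer κ.kerSubgroup ↥((↥(A.geomPrimaryTorsion 2))[(2 : ℤ)]) w) ∧
        (∀ (v : HeightOneSpectrum (𝓞 ℚ)), ((2 : ℕ) : 𝓞 ℚ) ∈ v.asIdeal → ∀ σ : Field.absoluteGaloisGroup ℚ,
          A.conjH1 2 κ.kerSubgroup σ
              (pushH1 κ.kerSubgroup ((↥(A.geomPrimaryTorsion 2))[(2 : ℤ)]).subtype (subtype_torsionBy_smul A 2)
                (pushH1 κ.kerSubgroup e'.toAddMonoidHom he' c)) ∈
            localKummerOverOfEmb A 2 κ.kerSubgroup (closureEmb (K := ℚ) (v.adicCompletion ℚ))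
              (⨆ n : ℕ, signedLocalPoints κ (v.adicCompletion ℚ) A 1 n))) := by
    intro W A _ _ _ _ hssW ha2W hssA ha2A e' he' c
    rintro ⟨ha, hb, hc⟩
    refine ⟨?_, ?_, ?_⟩
    · exact pushH1_mem_unramifiedOutside κ.kerSubgroup e'.toAddMonoidHom he' 2 _ ha
    · intro w σ
      have h := pushH1_mem_infKer κ.kerSubgroup e'.toAddMonoidHom he' w (hb w σ)
      rw [pushH1_conjH1] at h
      exact h
    · intro v hv σ
      exact signedKummer_transport W A hssW ha2W hssA ha2A κ e' he' c hv σ (hc v hv σ)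
  refine ⟨key W A hssW ha2W hssA ha2A e' he' c, fun h ↦ ?_⟩
  have h' := key A W hssA ha2A hssW ha2W e'.symm (addEquiv_symm_smul e' he') _ h
  rwa [pushH1_symm_pushH1 W A κ.kerSubgroup e' he' c] at h'

end Summit.BirchSwinnertonDyer.BirchSwinnertonDyer.Theorems.SignedTransportAtTwo

end
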